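import Summits.Ventures.QEC.Census.CertMitmK
import Summits.Ventures.QEC.Census.LP.LP96w8.Cert
import HarnessLib

/-!
# `LP96w8` — KERNEL meet-in-the-middle replay, side X, file 1/1 (emitted by qec-type-07, 07.MITMK)

Generic lane `Census/CertMitmK.lean` over the certificate data `LP/LP96w8/Cert.lean`: side X = X-type operators,
syndromes by `cert.HZ` (48 rows), `wmax = d − 1 = 5 = wa + wb = 3 + 2`. The table of all patterns of
weight `≤ 2` (1 part(s), kernel-built by `tabFindQ`, keys mixed at 48 bits) is self-checked (T1ᴿ,
`tableTestR`) and every pattern of weight `≤ 3` is probed against it (T3ᴿ, `probeTestR`, packed level-1 chunks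
`chunk1RF` of `Census/CertCheckBZFast.lean` = `CertChunks.chunk1R`); allow-list = (LP96w8.cert.sideX.found.map Prod.fst). 2 theorem(s) here,
each ONE `decide +kernel` (tier KERNEL: axioms ⊆ {propext, Classical.choice, Quot.sound}), run one at a time
(`Elab.async false`); ≈ 122 s of kernel time predicted by the emitter's replica (HOME/census/type-07/mitmk_lib.py),
which also pre-computed every verdict below as `true`. The end of this file ASSEMBLES the side (first-order terms only).
Do not edit; re-emit (HOME/census/type-07/emit_mitmk.py).
-/

set_option Elab.async false

namespace Summit.Ventures.QEC.Census.LP96w8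

/-- (T1ᴿ) Table part 0 of side X (`4657` patterns of weight `≤ 2` with first qubit in `[0, 96)` plus the empty pattern; `4657` distinct syndromes, tree depth 29): every pattern of the part finds a representative under its syndrome, equal to it up to `0` or an allow-listed stabilizer word. -/
theorem tX0 :
    chunk1RF (tableTestR (tabFindQ (posList 96 LP96w8.cert.HZ) 48 2 0 96) (LP96w8.cert.sideX.found.map Prod.fst)) (posList 96 LP96w8.cert.HZ) 1 0 96 = true := by
  decide +kernel

/-- (T3ᴿ) Probes with first qubit in `[0, 96)` (`147536` patterns of weight `1 … 3`) against table part 0 of side X: no hit, or hit up to `0` / an allow-listed stabilizer word. -/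
theorem pX0_0 :
    chunk1RF (probeTestR (tabFindQ (posList 96 LP96w8.cert.HZ) 48 2 0 96) (LP96w8.cert.sideX.found.map Prod.fst)) (posList 96 LP96w8.cert.HZ) 2 0 96 = true := by
  decide +kernel

/-- Side X, table part 0: EVERY probe of weight `≤ 3` passes (T3ᴿ) — `Reaches` assembled from the
1 packed chunk range(s) by `CertChunks.reaches_origin_of_chunk1` (the origin probe is the empty pattern:
`probeTestR _ _ 0 0` by `decide`). -/
theorem probesX0 :
    Reaches (probeTestR (tabFindQ (posList 96 LP96w8.cert.HZ) 48 2 0 96) (LP96w8.cert.sideX.found.map Prod.fst)) (posList 96 LP96w8.cert.HZ) 3 0 0 :=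
  reaches_origin_of_chunk1 96 (by decide +kernel) (by rw [probeTestR, tabFindQ_zero]; rfl)
    (forall_lt_append (forall_lt_zero) (forall_of_chunk1RF rfl pX0_0))

/-- **Side X of `LP96w8`, tier KERNEL**: every X-pattern of weight `≤ 2` is filed in a kernel-built table part
against which every probe of weight `≤ 3` passes (`DistCert.MitmKX`; assembled by `reachesP_origin_of_chunk1` from
the T1ᴿ part theorems and the `probesX·` statements; the empty pattern is covered by part 0 via
`tableTestR_tabFindQ_origin`). With `Census/CertMitmK.mitmK_lower_sound`: no X-logical of weight `≤ 5`. -/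
theorem mitmKX : LP96w8.cert.MitmKX (LP96w8.cert.sideX.found.map Prod.fst) 3 2 :=
  reachesP_origin_of_chunk1 96 (by decide +kernel)
    (coverP_origin (tabFindQ (posList 96 LP96w8.cert.HZ) 48 2 0 96) (tableTestR_tabFindQ_origin _ _ _ _ _ _) probesX0)
    (forall_lt_append (forall_lt_zero) (forall_coverP_of_chunk1RF tX0 probesX0))

end Summit.Ventures.QEC.Census.LP96w8
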